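import Mathlib
import HarnessLib
import Summits.QuantumFields.YangMills.Theses.GronwallGap
import Summits.QuantumFields.YangMills.Theorems.GronwallGapAnalyticDetourStrongCouplingWindow
import Summits.QuantumFields.YangMills.Theorems.GronwallGapStrongCouplingAnchor
import Summits.QuantumFields.YangMills.Theorems.GronwallGapWilsonWeightBridge

/-!
# `PathGapModulus` (stmt-QuantumFields-13946), line `registered`: the hypothesis class of the crux is inhabited,
# with a clustering parameter, for EVERY compact simple `G` (lead c5, cycle 6)

Route `GronwallGap`, sub-problem `YangMills`.  The crux
`Summit.QuantumFields.YangMills.Theses.GronwallGap.PathGapModulus` is equivalent (tree: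
`pathGapModulus_iff_noGapCollapse`, `pathGapModulus_iff_localTrichotomy`) to NoGapCollapse: along an ADMISSIBLE
single-plaquette weight path `w` (`Adm w`) with Gateaux-analytic torus pressure at every parameter
(`∀ s, AnP (w s)`), ONE volume-uniformly clustering parameter forces a common clustering rate at all parameters.
A statement of this shape is worthless if its hypothesis class is empty or never meets a clustering parameter
(it would then be vacuously true and could not feed the route's assembly, which applies it to the detour path of
`AnalyticDetour` anchored in the strong-coupling window).  This file certifies, sorry-free and unconditionally in
`G`, that for every compact simple Lie group `G` (the crux's own quantifier) there IS an admissible weight path with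
analytic pressure at every parameter whose parameter `s = 0` clusters volume-uniformly at a positive rate:
the Wilson path of the landed strong-coupling window (`stub_strongCouplingWindow`, AnalyticDetour line: the
Wilson segment inside `(0, β₁)` is admissible — positive type by the Schur-product/Gram argument — and has
Gateaux-analytic pressure by the Kotecký–Preiss + Vitali theorem `stub_nearHaarAnalytic`), started at
`βs := min β₀ β₁ / 2`, where `β₀` is the Osterwalder–Seiler anchor of `strongCouplingAnchor_proof`; the Wilson
clustering is rewritten as clustering of the `w 0`-theory by `wilsonWeightBridge_proof` exactly as in the route
glue `Summit.QuantumFields.YangMills.Theses.GronwallGap.closes`.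

So the crux is NOT vacuous: every proof must genuinely transport clustering, and the verified strong-coupling
region (`pathGapModulus_of_nearHaar`, p155815) is an honest model of hypotheses AND conclusion.
Pure glue of landed theorems; no named facts; no definitions.
-/

namespace Summit.QuantumFields.YangMills.Theorems

open scoped BigOperators
open MeasureTheory

/-- **The hypothesis class of `PathGapModulus` / NoGapCollapse is inhabited, with a clustering parameter, for
every compact simple `G`.**  In the crux's verbatim preamble: there is `w : ℝ → G → ℝ` with `Adm w`,
`AnP (w s)` for every `s ∈ [0,1]`, and `UCw w 0 m₀` for some `m₀ > 0` (the strong-coupling Wilson path of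
`stub_strongCouplingWindow` started at `min β₀ β₁ / 2`, clustering by `strongCouplingAnchor_proof` through
`wilsonWeightBridge_proof`). [folklore] -/
theorem pathGap_hypothesisClass_inhabited :
    ∀ (G : Type) [Group G] [TopologicalSpace G] [IsTopologicalGroup G] [CompactSpace G],
      Literature.MathematicalPhysics.QuantumFieldTheory.IsCompactSimpleLieGroup G →
      letI : MeasurableSpace G := borel G; haveI : BorelSpace G := ⟨rfl⟩;
      let UCw : (ℝ → G → ℝ) → ℝ → ℝ → Prop := fun w s m => ∀ A B : Literature.MathematicalPhysics.QuantumFieldTheory.YMSpecies G, ∃ C : ℝ, ∃ S₀ : ℕ, ∀ S : ℕ, S₀ ≤ S → ∀ n : ℕ, n ≤ S → |(∫ U, A.F (Literature.MathematicalPhysics.QuantumLattice.torusLift (2 * S + 1) U) * B.F (Literature.MathematicalPhysics.QuantumLattice.configShift (-Pi.single 0 (n : ℤ)) (Literature.MathematicalPhysics.QuantumLattice.torusLift (2 * S + 1) U)) ∂(Literature.MathematicalPhysics.QuantumLattice.groupHeatKernelMeasure (d := 4) (L := 2 * S + 1) w s)) - (∫ U, A.F (Literature.MathematicalPhysics.QuantumLattice.torusLift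 (2 * S + 1) U) ∂(Literature.MathematicalPhysics.QuantumLattice.groupHeatKernelMeasure (d := 4) (L := 2 * S + 1) w s)) * (∫ U, B.F (Literature.MathematicalPhysics.QuantumLattice.torusLift (2 * S + 1) U) ∂(Literature.MathematicalPhysics.QuantumLattice.groupHeatKernelMeasure (d := 4) (L := 2 * S + 1) w s))| ≤ C * Real.exp (-(m * n));
      let Pseq : (G → ℝ) → ℕ → ℝ := fun v L => (((L + 1 : ℕ) : ℝ) ^ 4)⁻¹ * Real.log (((MeasureTheory.Measure.pi fun _ : Literature.MathematicalPhysics.QuantumFieldTheory.Edge 4 (L + 1) => Literature.MathematicalPhysics.QuantumFieldTheory.haarProbability G).withDensity (fun U : Literature.MathematicalPhysics.QuantumFieldTheory.GaugeConfig 4 (L + 1) G => ENNReal.ofReal (Literature.MathematicalPhysics.QuantumLattice.groupHeatKernelWeight (fun _ : ℝ => v) 0 U))) Set.univ).toReal;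
      let AnP : (G → ℝ) → Prop := fun v => ∀ φ : G → ℝ, Continuous φ → (∀ g h : G, φ (h * g * h⁻¹) = φ g) → ∃ p : ℝ → ℝ, (∀ t : ℝ, Filter.Tendsto (fun L : ℕ => Pseq (fun g => v g * Real.exp (t * φ g)) L) Filter.atTop (nhds (p t))) ∧ AnalyticAt ℝ p 0;
      let Adm : (ℝ → G → ℝ) → Prop := fun w => (∀ s ∈ Set.Icc (0 : ℝ) 1, Continuous (w s) ∧ (∀ g : G, 0 < w s g) ∧ (∀ g h : G, w s (h * g * h⁻¹) = w s g) ∧ (∀ g : G, w s g⁻¹ = w s g) ∧ (∀ (n : ℕ) (x : Fin n → G) (c : Fin n → ℂ), 0 ≤ (∑ i, ∑ j, (starRingEnd ℂ) (c i) * c j * ((w s ((x i)⁻¹ * x j) : ℝ) : ℂ)).re)) ∧ ∃ Λ : ℝ, ∀ s ∈ Set.Icc (0 : ℝ) 1, ∀ s' ∈ Set.Icc (0 : ℝ) 1, ∀ g : G, |Real.log (w s g) - Real.log (w s' g)| ≤ Λ * |s - s'|;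
      ∃ w : ℝ → G → ℝ, Adm w ∧ (∀ s ∈ Set.Icc (0 : ℝ) 1, AnP (w s)) ∧ ∃ m₀ : ℝ, 0 < m₀ ∧ UCw w 0 m₀ := by
  intro G _ _ _ _ hG UCw Pseq AnP Adm
  letI : MeasurableSpace G := borel G
  haveI : BorelSpace G := ⟨rfl⟩
  have ghkm_congr : ∀ {L : ℕ} [NeZero L] {p q : ℝ → G → ℝ} {t t' : ℝ}, p t = q t' →
      Literature.MathematicalPhysics.QuantumLattice.groupHeatKernelMeasure (d := 4) (L := L) p t =
        Literature.MathematicalPhysics.QuantumLattice.groupHeatKernelMeasure (d := 4) (L := L) q t' := by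
    intro L _ p q t t' h
    exact (show Literature.MathematicalPhysics.QuantumLattice.groupHeatKernelMeasure (d := 4) (L := L) p t =
        Literature.MathematicalPhysics.QuantumLattice.groupHeatKernelMeasure (d := 4) (L := L) (fun _ : ℝ => p t) 0 from rfl).trans
      ((congrArg (fun f : G → ℝ => Literature.MathematicalPhysics.QuantumLattice.groupHeatKernelMeasure (d := 4) (L := L) (fun _ : ℝ => f) 0) h).trans
        (show Literature.MathematicalPhysics.QuantumLattice.groupHeatKernelMeasure (d := 4) (L := L) (fun _ : ℝ => q t') 0 =
          Literature.MathematicalPhysics.QuantumLattice.groupHeatKernelMeasure (d := 4) (L := L) q t' from rfl))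
  obtain ⟨r⟩ := hG.2
  obtain ⟨β₀, hβ₀, hanc⟩ := strongCouplingAnchor_proof G hG r
  obtain ⟨β₁, hβ₁, hwin⟩ := stub_strongCouplingWindow G hG r
  have hβs : 0 < min β₀ β₁ / 2 ∧ min β₀ β₁ / 2 < β₀ ∧ min β₀ β₁ / 2 < β₁ := by
    refine ⟨by positivity, ?_, ?_⟩
    · have := min_le_left β₀ β₁; linarith
    · have := min_le_right β₀ β₁; linarith
  obtain ⟨m₀, hm₀, hUC0⟩ := hanc (min β₀ β₁ / 2) ⟨hβs.1, hβs.2.1⟩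
  obtain ⟨w, hAdm, hAn, hw0, -⟩ := hwin (min β₀ β₁ / 2) ⟨hβs.1, hβs.2.2⟩ (min β₀ β₁ / 2) ⟨hβs.1, hβs.2.2⟩
  refine ⟨w, hAdm, hAn, m₀, hm₀, fun A B => ?_⟩
  obtain ⟨C, S₀, h⟩ := hUC0 A B
  refine ⟨C, S₀, fun S hS n hn => ?_⟩
  have hm0 : Literature.MathematicalPhysics.QuantumLattice.groupHeatKernelMeasure (d := 4) (L := 2 * S + 1) w 0 =
      Literature.MathematicalPhysics.QuantumFieldTheory.wilsonMeasure (d := 4) (L := 2 * S + 1) r.ρ (min β₀ β₁ / 2) := by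
    rw [wilsonWeightBridge_proof G hG r (2 * S + 1) (min β₀ β₁ / 2) 0]; exact ghkm_congr hw0
  rw [hm0]
  simpa [Literature.MathematicalPhysics.QuantumFieldTheory.latticeConnectedCorr] using h S hS n hn

end Summit.QuantumFields.YangMills.Theorems
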